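import Literature.Analysis.FluidPDE.DistributionalPressurePoisson
import Literature.Analysis.FluidPDE.NewtonKernel
import Literature.Analysis.FluidPDE.PressurePoisson
import HarnessLib

/-!
# The dipole potential flow `∇Γ`: Bernoulli identity, `div ∇θ = Δθ`, and exact steady potential flow off the origin

Analysis/FluidPDE proofs-layer file (theorems + one data definition `dipole`, no new `Prop` facts) over the
tree's `newtonKernel` / `newtonFar` (`NewtonKernel.lean`), `convect` / `VectorCalculus.divergence`
(`VectorCalculus.lean`) and `laplacian_gradient` (`DistributionalPressurePoisson.lean`). Written by the
disprover of route item `ScarRigidity` (stmt-NavierStokesRegularity-11717, route RellichScar) for the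
parabolic-exterior potential-flow counterexample `u = √(−t)∇Γ(x)`.
Bernoulli for potential flows `(∇θ·∇)∇θ = ∇(½|∇θ|²)` (`convect_gradient_self`), `div ∇θ = Δθ`
(`divergence_gradient`), `Δ∇θ = 0` where `Δθ` vanishes locally, and the dipole field `D = ∇Γ = x/(4π|x|³)`
(`Γ = newtonKernel`): `|D| = (4π|x|²)⁻¹`, smooth and non-vanishing off the origin, and an exact steady potential
flow there — `div D = 0`, `ΔD = 0`, `(D·∇)D = ∇(½|D|²)` (`dipole_identities`, through the smooth cut-off potential
`Γ∞ = newtonFar (ρ/2) ρ` of the tree). References: folklore vector calculus (Majda–Bertozzi, *Vorticity and Incompressible Flow*, §1.1–1.2;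
Gilbarg–Trudinger (2.12)–(2.13) for `Γ`, `DΓ`, `D²Γ`).
-/

noncomputable section

open Set Filter Function MeasureTheory Metric TopologicalSpace
open scoped Topology ENNReal NNReal InnerProductSpace RealInnerProductSpace Laplacian

namespace Literature.Analysis.FluidPDE


local notation "ℝ³" => EuclideanSpace ℝ (Fin 3)

/-! #### Calculus of gradient fields (global `C²`/`C³` potentials) -/

/-- Riesz: `(toDual).symm (innerSL v) = v`. [folklore] -/
theorem toDual_symm_innerSL (v : ℝ³) : (InnerProductSpace.toDual ℝ ℝ³).symm (innerSL ℝ v) = v := by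
  apply (InnerProductSpace.toDual ℝ ℝ³).injective
  rw [LinearIsometryEquiv.apply_symm_apply]
  ext y
  rfl

/-- Riesz, applied form through the coercion to a continuous linear map. [folklore] -/
theorem inner_toDualSymm_clm_apply (φ : ℝ³ →L[ℝ] ℝ) (v : ℝ³) :
    ⟪(((InnerProductSpace.toDual ℝ ℝ³).symm : (ℝ³ →L[ℝ] ℝ) →L[ℝ] ℝ³) φ), v⟫ = φ v :=
  InnerProductSpace.toDual_symm_apply

/-- The gradient field of a `C²` potential is differentiable, with derivative `Riesz ∘ D²θ(x)`.
[folklore] -/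
theorem hasFDerivAt_gradient {θ : ℝ³ → ℝ} (hθ : ContDiff ℝ 2 θ) (x : ℝ³) :
    HasFDerivAt (gradient θ)
      (((InnerProductSpace.toDual ℝ ℝ³).symm : (ℝ³ →L[ℝ] ℝ) →L[ℝ] ℝ³).comp
        (fderiv ℝ (fderiv ℝ θ) x)) x := by
  have hD : HasFDerivAt (fderiv ℝ θ) (fderiv ℝ (fderiv ℝ θ) x) x :=
    ((hθ.fderiv_right (m := 1) le_rfl).differentiable one_ne_zero x).hasFDerivAt
  exact (InnerProductSpace.toDual ℝ ℝ³).symm.hasFDerivAt.comp x hD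

/-- **Bernoulli for potential flows**: `(∇θ·∇)∇θ = ∇(½|∇θ|²)` for `θ ∈ C²` (symmetry of the
Hessian). [folklore] -/
theorem convect_gradient_self {θ : ℝ³ → ℝ} (hθ : ContDiff ℝ 2 θ) (x : ℝ³) :
    convect (gradient θ) (gradient θ) x = gradient (fun y => 2⁻¹ * ‖gradient θ y‖ ^ 2) x := by
  set L := (InnerProductSpace.toDual ℝ ℝ³).symm with hL
  set T := fderiv ℝ (fderiv ℝ θ) x with hT
  have hg := hasFDerivAt_gradient hθ x
  set Lc : (ℝ³ →L[ℝ] ℝ) →L[ℝ] ℝ³ := ((InnerProductSpace.toDual ℝ ℝ³).symm : (ℝ³ →L[ℝ] ℝ) →L[ℝ] ℝ³)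
    with hLc
  have h1 : convect (gradient θ) (gradient θ) x = Lc (T (gradient θ x)) := by
    rw [convect, hg.fderiv]
    rfl
  have hφ := hg.norm_sq.const_mul (2⁻¹ : ℝ)
  have hS : (2⁻¹ : ℝ) • (2 • (innerSL ℝ (gradient θ x)).comp (Lc.comp T)) =
      (innerSL ℝ (gradient θ x)).comp (Lc.comp T) := by
    rw [two_nsmul, smul_add, ← add_smul]
    norm_num
  have h2 : gradient (fun y => 2⁻¹ * ‖gradient θ y‖ ^ 2) x =
      L ((innerSL ℝ (gradient θ x)).comp (Lc.comp T)) := by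
    show L (fderiv ℝ (fun y => 2⁻¹ * ‖gradient θ y‖ ^ 2) x) = _
    rw [hφ.fderiv, hS]
  rw [h1, h2]
  show L (T (gradient θ x)) = L ((innerSL ℝ (gradient θ x)).comp (Lc.comp T))
  congr 1
  ext k
  have hsymm : IsSymmSndFDerivAt ℝ θ x := hθ.contDiffAt.isSymmSndFDerivAt (by simp)
  rw [ContinuousLinearMap.comp_apply, ContinuousLinearMap.comp_apply, innerSL_apply_apply,
    real_inner_comm, inner_toDualSymm_clm_apply]
  exact hsymm (gradient θ x) k

/-- `Δ ∇θ = 0` at points near which `Δθ` vanishes, for `θ ∈ C³`. [folklore] -/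
theorem laplacian_gradient_eq_zero {θ : ℝ³ → ℝ} (hθ : ContDiff ℝ 3 θ) {x : ℝ³}
    (h0 : Δ θ =ᶠ[𝓝 x] fun _ => (0 : ℝ)) : Δ (gradient θ) x = 0 := by
  rw [laplacian_gradient hθ x]
  show (InnerProductSpace.toDual ℝ ℝ³).symm (fderiv ℝ (Δ θ) x) = 0
  rw [h0.fderiv_eq, fderiv_fun_const]
  simp

/-! #### The dipole field `∇Γ` and its local potential `Γ∞` -/

/-- The dipole field `D(x) = x/(4π|x|³) = ∇Γ(x)` (`Γ = newtonKernel = −(4π|x|)⁻¹`; Gilbarg–Trudinger (2.13)).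
[folklore] -/
def dipole (x : ℝ³) : ℝ³ := (4 * Real.pi * ‖x‖ ^ 3)⁻¹ • x

/-- `∇Γ = D` off the origin (Riesz applied to `DΓ(x) = ⟨x,·⟩/(4π|x|³)`). [folklore] -/
theorem gradient_newtonKernel {x : ℝ³} (hx : x ≠ 0) : gradient newtonKernel x = dipole x := by
  show (InnerProductSpace.toDual ℝ ℝ³).symm (fderiv ℝ newtonKernel x) = dipole x
  rw [fderiv_newtonKernel hx, map_smul, toDual_symm_innerSL]
  rfl

/-- `|D(x)| = (4π|x|²)⁻¹` off the origin. [folklore] -/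
theorem norm_dipole {x : ℝ³} (hx : x ≠ 0) : ‖dipole x‖ = (4 * Real.pi * ‖x‖ ^ 2)⁻¹ := by
  rw [← gradient_newtonKernel hx]
  show ‖(InnerProductSpace.toDual ℝ ℝ³).symm (fderiv ℝ newtonKernel x)‖ = _
  rw [LinearIsometryEquiv.norm_map, norm_fderiv_newtonKernel hx]

/-- The dipole field vanishes nowhere off the origin. [folklore] -/
theorem dipole_ne_zero {x : ℝ³} (hx : x ≠ 0) : dipole x ≠ 0 := by
  rw [← norm_ne_zero_iff, norm_dipole hx]
  have : 0 < ‖x‖ := norm_pos_iff.2 hx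
  positivity

/-- The smooth potential `Γ∞ = newtonFar (ρ/2) ρ`, equal to `Γ` off the closed ball of radius `ρ`:
its gradient is the dipole field near every `x` with `ρ < ‖x‖`. [folklore] -/
theorem dipole_eventuallyEq_gradient_newtonFar {ρ : ℝ} (hρ : 0 < ρ) {x : ℝ³} (hx : ρ < ‖x‖) :
    dipole =ᶠ[𝓝 x] gradient (newtonFar (ρ / 2) ρ) := by
  have hopen : IsOpen {y : ℝ³ | ρ < ‖y‖} := isOpen_lt continuous_const continuous_norm
  filter_upwards [hopen.mem_nhds hx] with y hy
  have hy0 : y ≠ 0 := by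
    rintro rfl
    simp only [norm_zero] at hy
    linarith
  have hloc := newtonFar_eventuallyEq_newtonKernel (by linarith : 0 ≤ ρ / 2) (by linarith) hy
  rw [← gradient_newtonKernel hy0]
  show _ = (InnerProductSpace.toDual ℝ ℝ³).symm (fderiv ℝ (newtonFar (ρ / 2) ρ) y)
  rw [hloc.fderiv_eq]
  rfl

/-- `Γ∞` is `Cⁿ` for every finite `n` (cast of the tree's `contDiff_newtonFar`). [folklore] -/
theorem contDiff_newtonFar' {ρ : ℝ} (hρ : 0 < ρ) (n : ℕ) :
    ContDiff ℝ n (newtonFar (ρ / 2) ρ) := by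
  have := contDiff_newtonFar (by linarith : 0 < ρ / 2) (by linarith : ρ / 2 < ρ) (n := (n : ℕ∞))
  exact_mod_cast this

/-- `ΔΓ∞ = 0` near every `x` with `ρ < ‖x‖`. [folklore] -/
theorem laplacian_newtonFar_eventuallyEq_zero {ρ : ℝ} (hρ : 0 < ρ) {x : ℝ³} (hx : ρ < ‖x‖) :
    Δ (newtonFar (ρ / 2) ρ) =ᶠ[𝓝 x] fun _ => (0 : ℝ) := by
  have hopen : IsOpen {y : ℝ³ | ρ < ‖y‖} := isOpen_lt continuous_const continuous_norm
  filter_upwards [hopen.mem_nhds hx] with y hy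
  exact newtonFarLaplacian_eq_zero_of_gt (by linarith : 0 ≤ ρ / 2) (by linarith) hy

/-- **The dipole field is an exact steady potential flow off the origin**: `div D = 0`, `ΔD = 0`,
`(D·∇)D = ∇(½|D|²)` at every `x ≠ 0`. [folklore] -/
theorem dipole_identities {x : ℝ³} (hx : x ≠ 0) :
    VectorCalculus.divergence dipole x = 0 ∧ Δ dipole x = 0 ∧
      convect dipole dipole x = gradient (fun y => 2⁻¹ * ‖dipole y‖ ^ 2) x := by
  set ρ := ‖x‖ / 2 with hρdef
  have hρ : 0 < ρ := by have := norm_pos_iff.2 hx; positivity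
  have hxρ : ρ < ‖x‖ := by have := norm_pos_iff.2 hx; rw [hρdef]; linarith
  set θ := newtonFar (ρ / 2) ρ with hθ
  have hloc := dipole_eventuallyEq_gradient_newtonFar hρ hxρ
  have h2 : ContDiff ℝ 2 θ := contDiff_newtonFar' hρ 2
  have h3 : ContDiff ℝ 3 θ := contDiff_newtonFar' hρ 3
  have hΔ := laplacian_newtonFar_eventuallyEq_zero hρ hxρ
  refine ⟨?_, ?_, ?_⟩
  · rw [VectorCalculus.divergence, hloc.fderiv_eq, ← VectorCalculus.divergence, divergence_gradient h2 x,
      hΔ.eq_of_nhds]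
  · rw [(InnerProductSpace.laplacian_congr_nhds hloc).eq_of_nhds]
    exact laplacian_gradient_eq_zero h3 hΔ
  · have hsq : (fun y => 2⁻¹ * ‖dipole y‖ ^ 2) =ᶠ[𝓝 x] fun y => 2⁻¹ * ‖gradient θ y‖ ^ 2 := by
      filter_upwards [hloc] with y hy
      rw [hy]
    rw [convect, hloc.fderiv_eq, hloc.eq_of_nhds, ← convect, convect_gradient_self h2 x]
    show _ = (InnerProductSpace.toDual ℝ ℝ³).symm (fderiv ℝ (fun y => 2⁻¹ * ‖dipole y‖ ^ 2) x)
    rw [hsq.fderiv_eq]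
    rfl


/-- The dipole field is smooth off the origin. [folklore] -/
theorem contDiffAt_dipole {x : ℝ³} (hx : x ≠ 0) {n : WithTop ℕ∞} : ContDiffAt ℝ n dipole x := by
  have hn : ContDiffAt ℝ n (fun y : ℝ³ => ‖y‖) x := contDiffAt_norm ℝ hx
  have hden : ContDiffAt ℝ n (fun y : ℝ³ => (4 * Real.pi * ‖y‖ ^ 3)⁻¹) x := by
    refine (contDiffAt_const.mul (hn.pow 3)).inv ?_
    have : 0 < ‖x‖ := norm_pos_iff.2 hx
    positivity
  exact hden.smul contDiffAt_id

end Literature.Analysis.FluidPDE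

end
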